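import Mathlib
import HarnessLib
import Summits.ResolutionOfSingularities.ResolutionOfSingularities.Theorems.WildQuotientsWildQuotientResolutionS1aKillGlue

/-!
# S1a — AGREEING KILL CHARTS THAT COVER THE CLOSURES OF THEIR SUPPORTS: `KillChartsReach p` ((K3) absorbed into the cover condition)

[OURS · L1 W4.5c · lead-1 g9] — NOT statements of the manuscript; counted 0; AI-level work, weaker than expert review. Crux
stmt-ResolutionOfSingularities-17941, line `s1a-logminvertex` v9, registered research stub `stub_killTouchReach`. Route-independent.

`…S1aKillGlue` glued agreeing principal kill charts along a CLOSED `B ⊆ Z(M)` under (K3) `supp (𝒦ᵢ)_d ∩ Oᵢ ⊆ B`. The closed set `B` and (K3) are only used to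
keep the glued support inside the charted region. Here the hypothesis is the natural one: the charts COVER THE CLOSURES OF THEIR OWN SUPPORTS,
`closure (supp (𝒦ᵢ)_d ∩ Oᵢ) ⊆ ⋃ₖ Oₖ` — the supports may leave the bad locus (e.g. a kill surface through a bad curve) provided the agreeing charts follow them.
* ★★ `exists_isPrincipalCentre_of_charts` — agreeing principal-centre charts of one degree covering the closures of their supports glue to a PRINCIPAL CENTRE
  `J` with `J|Oᵢ = 𝒦ᵢ|Oᵢ`; every bad point of a chart lies in `supp J_d` (G1);
* research def **`KillChartsReach p`** (OURS CANDIDATE, asserted nowhere): at every reachable all-killable model, finitely many AGREEING principal kill charts of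
  one degree covering the closures of their supports, one of them containing a bad point;
* `killChartsReach_of_killAgreeReach` (the `B`-form implies it) and ★★ `killTouchReach_of_killChartsReach`.
Chain of typed K statements, each implying the next: `KillFamilyReach` (v7) ⇒ `KillTouchReach` (v8/v9, registered) ⇐ `KillChartsReach` ⇐ `KillAgreeReach`.
-/

set_option linter.dupNamespace false

noncomputable section

universe u

open CategoryTheory Limits AlgebraicGeometry TopologicalSpace Topology Opposite
open Literature.AlgebraicGeometry.Resolution Literature.AlgebraicGeometry.RelativeSpec
open Summit.ResolutionOfSingularities.ResolutionOfSingularities.Theorems.WildQuotientResolution.S1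
open Summit.ResolutionOfSingularities.ResolutionOfSingularities.Theorems.WildQuotientResolution.S1.NodeAtlas
open Summit.ResolutionOfSingularities.ResolutionOfSingularities.Theorems.WildQuotientResolution.S1.BlowupCharts
open Summit.ResolutionOfSingularities.ResolutionOfSingularities.Theorems.WildQuotientResolution.S1.G1Proof
open Summit.ResolutionOfSingularities.ResolutionOfSingularities.Theorems.WildQuotientResolution.S1.KillFamily
open Summit.ResolutionOfSingularities.ResolutionOfSingularities.Theorems.WildQuotientResolution.S1.CentreGluing
open Summit.ResolutionOfSingularities.ResolutionOfSingularities.Theorems.WildQuotientResolution.S1.ExtendRees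
open Summit.ResolutionOfSingularities.ResolutionOfSingularities.Theorems.WildQuotientResolution.S1.NodeChartAway
open Summit.ResolutionOfSingularities.ResolutionOfSingularities.Theorems.WildQuotientResolution.S1.KillGlue

namespace Summit.ResolutionOfSingularities.ResolutionOfSingularities.Theorems.WildQuotientResolution.S1.KillCharts

variable {p : ℕ} {X' X₁ : Scheme.{0}} {q : X' ⟶ X₁} {G : Type} [Group G] {ρ : G →* Aut X'} {g₀ : G}

/-- ★★ **AGREEING PRINCIPAL KILL CHARTS COVERING THE CLOSURES OF THEIR SUPPORTS GLUE TO A PRINCIPAL CENTRE.** On a model over a Noetherian base with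
separated underlying scheme (`G = ⟨g₀⟩` finite, `p` prime): finitely many principal-centre charts `(Oᵢ, 𝒦ᵢ)` of one degree `d > 0` whose filtrations agree
on every affine open inside `Oᵢ ∩ Oₖ` and such that `closure (supp (𝒦ᵢ)_d ∩ Oᵢ) ⊆ ⋃ₖ Oₖ` give a PRINCIPAL CENTRE `J` (the glued filtration) with
`J|Oᵢ = 𝒦ᵢ|Oᵢ` (so every `Oᵢ` is a principal-centre chart of `J`), `supp J_d ⊆ ⋃ᵢ closure (supp (𝒦ᵢ)_d ∩ Oᵢ)`, and every BAD point of every `Oᵢ` in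
`supp J_d`. [OURS · L1 W4.5c] -/
theorem exists_isPrincipalCentre_of_charts [Finite G] (hp : p.Prime) (hG : ∀ g : G, g ∈ Subgroup.zpowers g₀) (M : GameFrame.GModel p q G ρ g₀)
    (hB : M.HasNoetherianBase) [M.V.IsSeparated] {ι : Type} [Finite ι]
    (O : ι → M.act.StableAffineOpens) (𝒦 : ι → ReesFiltration M.V) {d : ℕ} (hd : 0 < d)
    (hprin : ∀ i, IsPrincipalCentreChart p M.act g₀ (𝒦 i) d (O i))
    (hagree : ∀ i k (U : M.V.affineOpens), U.1 ≤ (O i).1 → U.1 ≤ (O k).1 → ∀ n, ((𝒦 i).filtration U).ideal n = ((𝒦 k).filtration U).ideal n)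
    (hcl : ∀ i, closure ((((𝒦 i).ideal d).support : Set M.V) ∩ (O i).1) ⊆ ⋃ k, ((O k).1 : Set M.V)) :
    ∃ J : ReesFiltration M.V, IsPrincipalCentre p M.act g₀ J d ∧ (∀ i, IsPrincipalCentreChart p M.act g₀ J d (O i)) ∧
      (((J.ideal d).support : Set M.V) ⊆ ⋃ i, closure ((((𝒦 i).ideal d).support : Set M.V) ∩ (O i).1)) ∧
      ∀ i, ∀ v ∈ ((O i).1 : Set M.V), v ∈ M.badLocus → v ∈ ((J.ideal d).support : Set M.V) := by
  haveI : IsLocallyNoetherian M.V := M.isLocallyNoetherian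
  let J : ReesFiltration M.V := glue M.act O 𝒦
  have hJO : ∀ i, IsPrincipalCentreChart p M.act g₀ J d (O i) := fun i =>
    isPrincipalCentreChart_congr (hprin i) fun hO n => filtration_glue_eq O 𝒦 (fun i => (hprin i).1) hagree i n
  have hGst : ∀ (g : G) (n : ℕ), (J.ideal n).comap (M.act.aut g).hom = J.ideal n := comap_aut_glue hG O 𝒦 hprin
  have hsub : ((J.ideal d).support : Set M.V) ⊆ ⋃ i, closure ((((𝒦 i).ideal d).support : Set M.V) ∩ (O i).1) :=
    support_glue_subset (ρ := M.act) O 𝒦 d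
  have hcov : ((J.ideal d).support : Set M.V) ⊆ ⋃ k, ((O k).1 : Set M.V) :=
    hsub.trans (Set.iUnion_subset fun i => hcl i)
  refine ⟨J, ⟨hd, hGst, fun v => ?_⟩, hJO, hsub, fun i v hvi hv => g1 hp q G ρ g₀ hG M J d (O i) hB (hJO i) v hvi hv⟩
  by_cases hv : v ∈ ((J.ideal d).support : Set M.V)
  · obtain ⟨i, hvi⟩ := Set.mem_iUnion.mp (hcov hv)
    exact ⟨O i, hvi, Or.inl (hJO i)⟩
  · obtain ⟨O₀, hvO₀, hn⟩ := M.atlas v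
    obtain ⟨O'', hvO'', -, hO''W, hn''⟩ := exists_isNodeChart_le hn hvO₀ (J.ideal d).support.compl
      (preimage_support_compl M.act (fun g => hGst g d)) hv
    refine ⟨O'', hvO'', Or.inr ⟨hn'', fun n => filtration_eq_top_of_disjoint _ hd ⟨O''.1, hn''.1⟩ ?_ n⟩⟩
    rw [Set.disjoint_left]
    intro x hx hx'
    exact hO''W hx hx'

/-- **`KillChartsReach p`** (OURS CANDIDATE research statement, asserted nowhere; the K side as AGREEING KILL CHARTS): at every non-terminal model reachable
from the initial model of a crux datum with every bad point killable (`jInf = ⊥`), there are finitely many PRINCIPAL-CENTRE CHARTS `(Oᵢ, 𝒦ᵢ)` of one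
Veronese degree `d > 0` whose filtrations AGREE on every affine open inside `Oᵢ ∩ Oₖ` ((K1)), which COVER THE CLOSURES OF THEIR OWN SUPPORTS
(`closure (supp (𝒦ᵢ)_d ∩ Oᵢ) ⊆ ⋃ₖ Oₖ` — the kill charts follow the kill centre wherever it goes), and one of which contains a BAD point. Weaker than
`KillAgreeReach p` (`killChartsReach_of_killAgreeReach`); implies the registered `KillTouchReach p` (`killTouchReach_of_killChartsReach`). [OURS · L1 W4.5c] -/
def KillChartsReach (p : ℕ) : Prop :=
  ∀ (k : Type) [Field k] [CharP k p] [PerfectField k] (X' X₁ : Scheme.{0})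
    (f : X₁ ⟶ Spec (.of k)) (q : X' ⟶ X₁) (G : Type) [Group G] [Finite G]
    (ρ : G →* Aut X'), Nat.card G = p → IsSeparated f → LocallyOfFiniteType f → QuasiCompact f →
    IsIntegral X₁ → ∀ [IsIntegral X'], Scheme.IsRegular X' → IsFinite q → Function.Surjective q.base →
    (∃ U : X₁.Opens, Dense (U : Set X₁) ∧ Etale (q ∣_ U)) →
    ∀ (hq : ∀ g : G, (ρ g).hom ≫ q = q),
    (∀ x y : X', q.base x = q.base y → ∃ g : G, (ρ g).hom.base x = y) →
    topologicalKrullDim X₁ ≤ 4 → Function.Injective ρ →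
    ∀ (g₀ : G), (∀ g : G, g ∈ Subgroup.zpowers g₀) → ∀ [IsLocallyNoetherian X']
      (h₀ : NodeAtlas p (⟨ρ, hq⟩ : ActionOver q G) g₀),
      ∀ M : GameFrame.GModel p q G ρ g₀, (GameFrame.GModel.initial hq h₀).Reachable M → ¬ M.Terminal → M.jInf = ⊥ →
        ∃ (n : ℕ) (O : Fin n → M.act.StableAffineOpens) (𝒦 : Fin n → ReesFiltration M.V) (d : ℕ), 0 < d ∧
          (∀ i, IsPrincipalCentreChart p M.act g₀ (𝒦 i) d (O i)) ∧
          (∀ i j (U : M.V.affineOpens), U.1 ≤ (O i).1 → U.1 ≤ (O j).1 →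
            ∀ m, ((𝒦 i).filtration U).ideal m = ((𝒦 j).filtration U).ideal m) ∧
          (∀ i, closure ((((𝒦 i).ideal d).support : Set M.V) ∩ (O i).1) ⊆ ⋃ k, ((O k).1 : Set M.V)) ∧
          ∃ i, (M.badLocus ∩ (O i).1).Nonempty

/-- **The `B`-form implies the charts form**: `KillAgreeReach p ⇒ KillChartsReach p` (with `B` closed and `supp ∩ Oᵢ ⊆ B ⊆ ⋃ Oₖ`, the closures of the
chart supports stay in the charted region; a point of the non-empty `B ⊆ Z(M)` lies in some chart). [OURS · L1 W4.5c] -/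
theorem killChartsReach_of_killAgreeReach {p : ℕ} (h : KillAgreeReach p) : KillChartsReach p := by
  intro k _ _ _ X' X₁ f q G _ _ ρ hG hfs hfft hfqc hX₁ _ hreg hqfin hqs hqet hq horb hdim hinj g₀ hg₀ _ h₀ M hR hT hj
  obtain ⟨B, n, O, 𝒦, d, hBne, hBc, hBbad, hBcov, hd, hprin, hsupp, hagree⟩ :=
    h k X' X₁ f q G ρ hG hfs hfft hfqc hX₁ hreg hqfin hqs hqet hq horb hdim hinj g₀ hg₀ h₀ M hR hT hj
  refine ⟨n, O, 𝒦, d, hd, hprin, hagree, fun i => (closure_minimal (hsupp i) hBc).trans hBcov, ?_⟩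
  obtain ⟨v, hv⟩ := hBne
  obtain ⟨i, hvi⟩ := Set.mem_iUnion.mp (hBcov hv)
  exact ⟨i, v, hBbad hv, hvi⟩

/-- ★★ **AGREEING KILL CHARTS IMPLY THE TOUCH FORM**: `KillChartsReach p ⇒ KillTouchReach p`. [OURS · L1 W4.5c] -/
theorem killTouchReach_of_killChartsReach {p : ℕ} (hp : p.Prime) (h : KillChartsReach p) : KillTouchReach p := by
  intro k _ _ _ X' X₁ f q G _ _ ρ hG hfs hfft hfqc hX₁ _ hreg hqfin hqs hqet hq horb hdim hinj g₀ hg₀ _ h₀ M hR hT hj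
  haveI := hfs
  haveI := hfft
  haveI := hqfin
  haveI : M.V.IsSeparated := isSeparated_of_datum f M
  obtain ⟨n, O, 𝒦, d, hd, hprin, hagree, hcl, i, v, hv, hvi⟩ :=
    h k X' X₁ f q G ρ hG hfs hfft hfqc hX₁ hreg hqfin hqs hqet hq horb hdim hinj g₀ hg₀ h₀ M hR hT hj
  obtain ⟨J, hJ, -, -, hbad⟩ := exists_isPrincipalCentre_of_charts hp hg₀ M (GameFrame.GModel.hasNoetherianBase_of_datum f M) O 𝒦 hd hprin hagree hcl
  exact ⟨J, d, hJ, v, hv, hbad i v hvi hv⟩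

end Summit.ResolutionOfSingularities.ResolutionOfSingularities.Theorems.WildQuotientResolution.S1.KillCharts

end
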